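import Summits.ResolutionOfSingularities.ResolutionOfSingularities.Theorems.MarkedTransferCampaignW46ThreefoldsGammaFreeGlobalMeasureSums
import Summits.ResolutionOfSingularities.ResolutionOfSingularities.Theorems.MarkedTransferCampaignW46ThreefoldsGammaFreeGlobalLift
import HarnessLib

/-!
# [OURS · L1 W4.6 rung (ii), dimension ladder] THE ONE-STEP LEXICOGRAPHIC DROP OF THE TERMINATION MEASURE `(Δ, Σ(i−1), Σ(k−2)⁺)`
# when a non-snc point of the boundary is blown up (brick B10b of rung (ii-2) `GammaFreeGlobalOrderReductionDimLE p 2`)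

Cell res-hironaka, LADDER-RESOLUTION rung L (D-0089), slot W4.6, rung (ii) (dimension ladder, res-L1-type-o1 p496755); seat
res-D-pv-049 AS res-L1-s46-pv-11 (holder of rung (ii-2); architecture v2, STATUS 2026-08-27T05:4xZ). Host route MarkedTransfer,
host item `HypersurfaceOrderReductionDimLeThree` (stmt-ResolutionOfSingularities-16156); proposed `--kind proof --supports` it
`--as helper`. Everything here is OURS; nothing of H. Hironaka's manuscript [Hironaka2017] is asserted. AI-written; AI review is
weaker than expert review.

## What is proved

`exists_family_measure_lt` — `X` regular integral Noetherian quasi-excellent of dimension `≤ 2`, `x` a closed point with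
`dim 𝒪_{X,x} = 2` which is NOT an snc point of the boundary of `V(J)` (`J ≠ 0`), `π : X′ → X` the blowing up of `𝓘_{x}`, and a
prime-divisor family `(ζ_k, i_k : C_k ↪ X)` of `V(J)` (brick B10a): there is a prime-divisor family of the controlled transform
`J′ = (J𝒪_{X′}) ⊗ 𝒪(mE)` on `X′` whose measure `(Δ, Σ(i−1), Σ(k−2)⁺)` (bricks B10b-defs) is LEXICOGRAPHICALLY SMALLER. By the
trichotomy of non-snc points (brick B10b-snc): (A) a branch singular at `x` — strict transforms, `Δ` drops (bricks B8b/B10b-fam);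
(B) all branches regular at `x`, two tangent — the same curves lifted (B8c/B10b-reg), `Δ` equal, `Σ(i−1)` drops (Noether's
inequality, B10b-loc, B10b-fibre, B10b-sums); (C) all regular, pairwise transversal, at least three — `Δ`, `Σ(i−1)` do not go up and
`Σ(k−2)⁺` drops. This is the induction step of the `d = 2` loop (Hartshorne V Thm. 3.9 pattern).

## Sources

* R. Hartshorne, *Algebraic Geometry* (1977), Ch. V Thm. 3.9. [Hartshorne1977]
* J. Kollár, *Lectures on Resolution of Singularities* (2007), Thm. 1.47, §1.4. [Kollar2007]
* H. Hironaka, ms. 2017-03-23, Def. 2.1 p.5 — scope only, under adjudication, not cited as fact. [Hironaka2017]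
-/

noncomputable section

set_option linter.dupNamespace false -- mandated namespace of this single-conjunct summit

open CategoryTheory AlgebraicGeometry TopologicalSpace IsLocalRing Topology

namespace Summit.ResolutionOfSingularities.ResolutionOfSingularities.Theorems

namespace CampaignW46

open Literature.AlgebraicGeometry.Resolution
open Scheme.IdealSheafData

universe u

/-- **[OURS · W4.6 rung (ii-2), brick B10b] Blowing up a non-snc point of `Sing(J, m)`… of the boundary lowers the measure.**
See the module docstring. [cite: Hartshorne1977, Ch. V Thm. 3.9] -/
theorem exists_family_measure_lt {X X' : Scheme.{u}} [IsIntegral X] [IsNoetherian X] (hX : Scheme.IsRegular X)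
    (hXq : Scheme.IsQuasiExcellent X) (hdim : topologicalKrullDim X ≤ 2) {x : X} (hx : IsClosed ({x} : Set X))
    (hxne : ({x} : Set X) ≠ Set.univ) (hR2 : ringKrullDim (X.presheaf.stalk x) = 2)
    {π : X' ⟶ X} (hπ : IsBlowup π (vanishingIdeal ⟨{x}, hx⟩)) {J : X.IdealSheafData} (hJ : J ≠ ⊥) (m : ℕ)
    {ι : Type} [Finite ι] (ζ : ι → X) (C : ι → Scheme.{u}) (i : ∀ k, C k ⟶ X) (hζinj : Function.Injective ζ)
    (hζrange : Set.range ζ = divisorialPoints J)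
    (hfam : ∀ k, IsClosedImmersion (i k) ∧ ∃ (_ : IsIntegral (C k)) (_ : IsNoetherian (C k)),
      Scheme.IsQuasiExcellent (C k) ∧ topologicalKrullDim (C k) ≤ 1 ∧ i k (genericPoint (C k)) = ζ k)
    (hsnc : ¬ SNCAt (((finite_divisorialPoints hJ).toFinset.toList).map primeDivisorIdeal) x) :
    ∃ (ι' : Type) (_ : Finite ι') (ζ' : ι' → X') (C' : ι' → Scheme.{u}) (i' : ∀ k', C' k' ⟶ X')
      (hfam' : ∀ k', IsClosedImmersion (i' k') ∧ ∃ (_ : IsIntegral (C' k')) (_ : IsNoetherian (C' k')),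
        Scheme.IsQuasiExcellent (C' k') ∧ topologicalKrullDim (C' k') ≤ 1 ∧ i' k' (genericPoint (C' k')) = ζ' k'),
      Function.Injective ζ' ∧ Set.range ζ' = divisorialPoints (controlledTransform π (vanishingIdeal ⟨{x}, hx⟩) J m) ∧
      toLex (@familyDelta ι' C' (fun k' => (hfam' k').2.1), toLex (familyTangency ζ', familyExcess ζ')) <
        toLex (@familyDelta ι C (fun k => (hfam k).2.1), toLex (familyTangency ζ, familyExcess ζ)) := by
  classical
  haveI : IsLocallyNoetherian X := inferInstance
  -- the family: coheights, instances, generic points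
  have hcoh : ∀ k, Order.coheight (ζ k) = 1 := fun k =>
    ((mem_divisorialPoints_iff J (ζ k)).mp (hζrange ▸ ⟨k, rfl⟩)).2
  have hζx : ∀ k, ζ k ≠ x := fun k => ne_of_coheight_eq_one_of_ringKrullDim_eq_two (hcoh k) hR2
  have hxJ : x ∉ divisorialPoints J := fun h => by
    have h1 := ((mem_divisorialPoints_iff J x).mp h).2
    have h2 := ringKrullDim_stalk_eq_coheight x
    rw [hR2, h1] at h2
    exact absurd h2 (by decide)
  haveI hci : ∀ k, IsClosedImmersion (i k) := fun k => (hfam k).1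
  haveI hint : ∀ k, IsIntegral (C k) := fun k => (hfam k).2.1
  haveI hN : ∀ k, IsNoetherian (C k) := fun k => (hfam k).2.2.1
  have hgen : ∀ k, i k (genericPoint (C k)) = ζ k := fun k => (hfam k).2.2.2.2.2
  have hfinδ : ∀ k, ∑ᶠ c, pointDelta (C k) c ≠ ⊤ := fun k =>
    finsum_pointDelta_ne_top (hfam k).2.2.2.1 (hfam k).2.2.2.2.1
  have hthrough : ∀ k (c : C k), i k c = x → ζ k ⤳ x := fun k c hc => by
    have := (specializes_iff_exists_eq_of_isClosedImmersion (i k) x).mpr ⟨c, hc⟩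
    rwa [hgen] at this
  -- the boundary list read on the family
  have hL : ∀ D, D ∈ ((finite_divisorialPoints hJ).toFinset.toList).map primeDivisorIdeal ↔
      ∃ k, primeDivisorIdeal (ζ k) = D := by
    intro D
    simp only [List.mem_map, Finset.mem_toList, Set.Finite.mem_toFinset]
    constructor
    · rintro ⟨ζ₀, hζ₀, rfl⟩
      rw [← hζrange] at hζ₀
      obtain ⟨k, rfl⟩ := hζ₀
      exact ⟨k, rfl⟩
    · rintro ⟨k, rfl⟩
      exact ⟨ζ k, hζrange ▸ ⟨k, rfl⟩, rfl⟩
  -- the blown-up surface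
  haveI : IsIntegral X' := hπ.isIntegral (vanishingIdeal_singleton_ne_bot hx hxne)
  haveI : IsProper π := hπ.isProper
  haveI : IsLocallyNoetherian X' := LocallyOfFiniteType.isLocallyNoetherian π
  haveI : CompactSpace X' := QuasiCompact.compactSpace_of_compactSpace π
  haveI : IsNoetherian X' := {}
  have hXq' : Scheme.IsQuasiExcellent X' := hπ.isQuasiExcellent hXq
  have hdim' : topologicalKrullDim X' ≤ 2 := hπ.topologicalKrullDim_le hdim
  -- the trichotomy of the non-snc point `x`
  rcases not_sncAt_trichotomy hX _ ζ hL hcoh hR2 hsnc with ⟨k₀, hk₀x, hk₀⟩ | hBC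
  · /- (A) a branch singular at `x`: strict transforms, `Δ` drops -/
    obtain ⟨ζ', C', i', hinj', hrange', hfam', hinl, hinr, hδ, hδE⟩ :=
      exists_family_pointBlowup hX hXq hdim hx hxne hπ J m hxJ ζ C i hζinj hζrange hfam
    haveI hint' : ∀ k', IsIntegral (C' k') := fun k' => (hfam' k').2.1
    refine ⟨_, inferInstance, ζ', C', i', hfam', hinj', hrange', Prod.Lex.toLex_lt_toLex.mpr (Or.inl ?_)⟩
    obtain ⟨c, hc⟩ := (specializes_iff_exists_eq_of_isClosedImmersion (i k₀) x).mp (by rw [hgen]; exact hk₀x)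
    have hsing : c ∉ Scheme.regularLocus (C k₀) := fun h =>
      hk₀ ((mem_regularLocus_iff_of_isClosedImmersion' (i k₀) c hc (hgen k₀)).mp h)
    exact familyDelta_lt_of_inl_le C C' hfinδ (fun k => (hδ k (hint' _) (hint k)).1)
      ⟨k₀, (hδ k₀ (hint' _) (hint k₀)).2 ⟨c, hc, hsing⟩⟩ (fun s => hδE s (hint' _))
  · /- (B), (C): all branches through `x` regular: lift the same curves -/
    have hregall : ∀ k, ζ k ⤳ x →
        IsRegularLocalRing (X.presheaf.stalk x ⧸ stalkIdeal (primeDivisorIdeal (ζ k)) x) :=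
      hBC.elim (fun h => h.1) (fun h => h.1)
    have hreg : ∀ k (c : C k), i k c = x → c ∈ Scheme.regularLocus (C k) := fun k c hc =>
      (mem_regularLocus_iff_of_isClosedImmersion' (i k) c hc (hgen k)).mpr (hregall k (hthrough k c hc))
    obtain ⟨j, η, hη, hjk, hinj', hrange', hEint, hEN, hEq, hEd, hEgen, hEreg, hEδ⟩ :=
      exists_family_pointBlowup_of_regular hX hXq hdim hx hxne hπ J m hxJ ζ C i hζinj hζrange hfam hreg
    -- the new family: the lifted curves and the exceptional curve
    let σ := PLift ((m : ℕ∞) < idealOrder J x)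
    let C' : ι ⊕ σ → Scheme.{u} := Sum.elim C fun _ => (primeDivisorIdeal η).subscheme
    let i' : ∀ k', C' k' ⟶ X' := fun k' => match k' with
      | Sum.inl k => j k
      | Sum.inr _ => (primeDivisorIdeal η).subschemeι
    let ζ' : ι ⊕ σ → X' :=
      Sum.elim (fun k => haveI : IsIntegral (C k) := (hfam k).2.1; j k (genericPoint (C k))) fun _ => η
    have hfam' : ∀ k', IsClosedImmersion (i' k') ∧ ∃ (_ : IsIntegral (C' k')) (_ : IsNoetherian (C' k')),
        Scheme.IsQuasiExcellent (C' k') ∧ topologicalKrullDim (C' k') ≤ 1 ∧ i' k' (genericPoint (C' k')) = ζ' k' := by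
      rintro (k | s)
      · exact ⟨(hjk k).1, (hfam k).2.1, (hfam k).2.2.1, (hfam k).2.2.2.1, (hfam k).2.2.2.2.1, rfl⟩
      · exact ⟨inferInstanceAs (IsClosedImmersion (primeDivisorIdeal η).subschemeι), hEint, hEN, hEq, hEd, hEgen⟩
    haveI hint' : ∀ k', IsIntegral (C' k') := fun k' => (hfam' k').2.1
    have hcoh' : ∀ k', Order.coheight (ζ' k') = 1 := fun k' => by
      have hmem : ζ' k' ∈ divisorialPoints (controlledTransform π (vanishingIdeal ⟨{x}, hx⟩) J m) := by
        rw [← hrange']; exact ⟨k', rfl⟩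
      exact ((mem_divisorialPoints_iff _ (ζ' k')).mp hmem).2
    have hinl : ∀ k, ζ' (Sum.inl k) = j k (genericPoint (C k)) := fun k => rfl
    have hinr : ∀ s : σ, ζ' (Sum.inr s) = η := fun s => rfl
    have hjζ : ∀ k, π (j k (genericPoint (C k))) = ζ k := fun k => (hjk k).2.2
    haveI : ∀ k, IsClosedImmersion (j k) := fun k => (hjk k).1
    haveI : ∀ k, IsClosedImmersion (j k ≫ π) := fun k => by rw [(hjk k).2.1]; exact (hfam k).1
    refine ⟨ι ⊕ σ, inferInstance, ζ', C', i', hfam', hinj', hrange', ?_⟩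
    -- `Δ` is unchanged
    have hΔ : familyDelta C' = familyDelta C := familyDelta_sum_eq C C' (fun k => rfl) (fun s => hEδ)
    have hT := familyTangency_le hX hXq hdim hx hxne hR2 hπ hXq' hdim' ζ hζinj hcoh hζx C j hjζ hη ζ' hinj' hcoh' hinl hinr
    refine Prod.Lex.toLex_lt_toLex.mpr (Or.inr ⟨hΔ, ?_⟩)
    rcases hBC with ⟨-, htan⟩ | ⟨-, htr, h3⟩
    · /- (B) a tangent pair: `Σ(i−1)` drops -/
      exact Prod.Lex.toLex_lt_toLex.mpr (Or.inl (Nat.lt_of_succ_le (hT.2 htan)))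
    · /- (C) pairwise transversal, at least three branches: `Σ(k−2)⁺` drops -/
      have hN := familyExcess_add_one_le hX hXq hdim hx hxne hR2 hπ hXq' hdim' ζ hζinj hcoh hζx C j hjζ hη ζ' hinj' hcoh'
        hinl hinr htr (by rw [branchCount_def]; exact h3)
      rcases hT.1.lt_or_eq with hlt | heq
      · exact Prod.Lex.toLex_lt_toLex.mpr (Or.inl hlt)
      · exact Prod.Lex.toLex_lt_toLex.mpr (Or.inr ⟨heq, Nat.lt_of_succ_le hN⟩)

end CampaignW46

end Summit.ResolutionOfSingularities.ResolutionOfSingularities.Theorems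

end
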